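import Summits.Ventures.Crystal3D.Theorems.StickyWulffConstantCoaxialWallLawExitCountBelow
import HarnessLib

/-!
# The line automaton of the co-axial cell: the sources (vertical tops of the inner sample) are a flux

HONEST FRAMING. Part of the venture `Summits/Ventures/Crystal3D` (cell `crystal3d-full`), helper for the
crux `CoaxialWallLaw` (stmt-Ventures-19481) of `route-Ventures-StickyWulffConstant`, REGISTERED line
`WallLedgerF` (planner cf-p1 gen 16), open stub `stub_coaxialTwoSlabAdhesion` (general fillings).  Brick 8 of
the FLUX-GAP architecture (memo F-FLUXGAP-ARCH §2): the STARTS of the automaton (`start_of_top`,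
`…AutomatonCount`) are supplied by the tops of the slot lines of the inner bottom sample.  Rung credit only;
F-C1 not moved.

* `card_vertical_tops_ge` — for the inner sample `P′ = Λ₁ ∩ {−2R₀ + 1 ≤ p₂ ≤ −R₀ − 1, lateral ≤ (ρ − 1)²}`
  of the complete bottom sample `P₁` (`3 ≤ R₀ ≤ ρ`) and a NON-DESCENDING slot `u` of grain 1, the balls
  `p ∈ P′` with a full shell in `X` whose successor `p + A₁ u` has left the window UPWARDS
  (`−R₀ − 1 < (p + A₁ u)₂ < zcut`, any `zcut ≥ −R₀ + 1`) number at least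
  `√2 |⟪A₁ u, e₃⟫| π (ρ − 1)² − 10 √2 π (ρ − 1) − 36 R₀ ρ`: every `u`-line through `P′` has a top
  (`tops_ge_lineCount`), a top off the rim leaves through the upper face, and the rim tops are `O(R₀ ρ)`
  (`card_mul_le_of_separated_in_shell`).

WHAT THIS IS NOT: not the stub; F-C1 not moved.
-/

noncomputable section

namespace Summit.Ventures.Crystal3D.Theorems

open Summit.Ventures.Crystal3D Finset
open Literature.MathematicalPhysics.StatisticalMechanics (fccStacking)
open scoped InnerProductSpace

open scoped Classical in
/-- **The vertical tops of the inner sample are a flux.**  See the module docstring. -/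
theorem card_vertical_tops_ge
    (A : EuclideanSpace ℝ (Fin 3) ≃ₗᵢ[ℝ] EuclideanSpace ℝ (Fin 3)) (t : EuclideanSpace ℝ (Fin 3))
    (X P P' : Finset (EuclideanSpace ℝ (Fin 3))) (R₀ ρ zcut : ℝ) (hR₀ : 3 ≤ R₀) (hρ : R₀ ≤ ρ)
    (hzcut : -R₀ + 1 ≤ zcut)
    (hX : ∀ p ∈ X, ∀ q ∈ X, p ≠ q → 1 ≤ dist p q) (hPX : P ⊆ X)
    (hP : ∀ p, p ∈ P ↔ (p ∈ (fun q => A q + t) '' fccStacking 1 (Real.sqrt (2 / 3)) ∧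
      -(2 * R₀) ≤ p 2 ∧ p 2 ≤ -R₀ ∧ p 0 ^ 2 + p 1 ^ 2 ≤ ρ ^ 2))
    (hP' : ∀ p, p ∈ P' ↔ (p ∈ (fun q => A q + t) '' fccStacking 1 (Real.sqrt (2 / 3)) ∧
      -(2 * R₀) + 1 ≤ p 2 ∧ p 2 ≤ -R₀ - 1 ∧ p 0 ^ 2 + p 1 ^ 2 ≤ (ρ - 1) ^ 2))
    {u : EuclideanSpace ℝ (Fin 3)} (hu : u ∈ fccSlots)
    (hup : 0 ≤ ⟪A u, EuclideanSpace.single (2 : Fin 3) (1 : ℝ)⟫_ℝ) :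
    Real.sqrt 2 * |⟪A u, EuclideanSpace.single (2 : Fin 3) (1 : ℝ)⟫_ℝ| * Real.pi * (ρ - 1) ^ 2 -
        10 * Real.sqrt 2 * Real.pi * (ρ - 1) - 36 * R₀ * ρ ≤
      ((P'.filter fun p => (∀ w ∈ fccSlots, p + A w ∈ X) ∧
          -R₀ - 1 < (p + A u) 2 ∧ (p + A u) 2 < zcut).card : ℝ) := by
  have hρ1 : (1 : ℝ) ≤ ρ := by linarith
  -- the inner sample is part of the sample, hence of `X`
  have hP'P : P' ⊆ P := by
    intro p hp
    obtain ⟨hΛ, h1, h2, h3⟩ := (hP' p).1 hp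
    rw [hP]
    have hρ0 : (0 : ℝ) ≤ ρ - 1 := by linarith
    exact ⟨hΛ, by linarith, by linarith, by nlinarith⟩
  have hP'X : P' ⊆ X := hP'P.trans hPX
  -- all tops
  have hP'w : ∀ p, p ∈ P' ↔ (p ∈ (fun q => A q + t) '' fccStacking 1 (Real.sqrt (2 / 3)) ∧
      (-(2 * R₀) + 1) ≤ p 2 ∧ p 2 ≤ (-(2 * R₀) + 1) + (R₀ - 2) ∧ p 0 ^ 2 + p 1 ^ 2 ≤ (ρ - 1) ^ 2) := by
    intro p; rw [hP' p, show -(2 * R₀) + 1 + (R₀ - 2) = -R₀ - 1 by ring]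
  obtain ⟨Ea, Eb, hEa, hEb, hdet, hframe, -⟩ := exists_frame_of_mem_fccSlots hu
  have htops := tops_ge_lineCount A t (-(2 * R₀) + 1) (R₀ - 2) (ρ - 1) (by linarith) (by linarith) P' hP'w
    Ea Eb u hEa hEb (norm_eq_one_of_mem_fccSlots hu) hdet hframe
  set T := P'.filter fun p => p + A u ∉ P' with hT
  set GOOD := P'.filter fun p => (∀ w ∈ fccSlots, p + A w ∈ X) ∧
      -R₀ - 1 < (p + A u) 2 ∧ (p + A u) 2 < zcut with hGOOD
  set RIM := P'.filter fun p => (ρ - 2) ^ 2 < p 0 ^ 2 + p 1 ^ 2 with hRIM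
  -- split the tops
  have hsplit : T ⊆ GOOD ∪ RIM := by
    intro p hp
    rw [hT, mem_filter] at hp
    obtain ⟨hpP', hnot⟩ := hp
    obtain ⟨hΛ, h1, h2, h3⟩ := (hP' p).1 hpP'
    rw [mem_union]
    by_cases hr : (ρ - 2) ^ 2 < p 0 ^ 2 + p 1 ^ 2
    · exact Or.inr (by rw [hRIM, mem_filter]; exact ⟨hpP', hr⟩)
    · left
      push Not at hr
      rw [hGOOD, mem_filter]
      have hu2 : (p + A u) 2 = p 2 + ⟪A u, EuclideanSpace.single (2 : Fin 3) (1 : ℝ)⟫_ℝ := by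
        rw [PiLp.add_apply, apply_two_eq_inner_e₃ (A u)]
      have hu1 : ⟪A u, EuclideanSpace.single (2 : Fin 3) (1 : ℝ)⟫_ℝ ≤ 1 := (abs_le.1 (abs_inner_slot_le_one A hu)).2
      refine ⟨hpP', fun w hw => hPX (inner_sample_full_window A t P (-(2 * R₀)) (-R₀) ρ hρ1 hP hΛ h1
        (by linarith) h3 hw), ?_, ?_⟩
      · -- off the rim the top leaves through the upper face
        by_contra hle
        push Not at hle
        apply hnot
        rw [hP']
        have hρ2 : (0 : ℝ) ≤ ρ - 2 := by linarith
        have hlat : (p + A u) 0 ^ 2 + (p + A u) 1 ^ 2 ≤ (ρ - 2 + 1) ^ 2 := by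
          refine lateral_sq_le_of_dist_le_one (y := p + A u) (q := p) (r := ρ - 2) hρ2 hr ?_
          rw [dist_eq_norm, add_sub_cancel_left, LinearIsometryEquiv.norm_map, norm_eq_one_of_mem_fccSlots hu]
        refine ⟨movedFcc_add_site_mem A t hΛ (mem_fcc_of_mem_fccSlots hu), by rw [hu2]; linarith, hle, ?_⟩
        rw [show ρ - 2 + 1 = ρ - 1 by ring] at hlat; exact hlat
      · rw [hu2]; linarith
  -- the rim tops are few
  have hRIMle : (RIM.card : ℝ) ≤ 36 * R₀ * ρ := by
    have hsep : ∀ p ∈ RIM, ∀ q ∈ RIM, p ≠ q → 1 ≤ dist p q :=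
      fun p hp q hq hpq => hX p (hP'X (mem_filter.1 hp).1) q (hP'X (mem_filter.1 hq).1) hpq
    have hmem : ∀ p ∈ RIM, -(2 * R₀) + 1 ≤ p 2 ∧ p 2 ≤ -R₀ - 1 ∧ (ρ - 2) ^ 2 < p 0 ^ 2 + p 1 ^ 2 ∧
        p 0 ^ 2 + p 1 ^ 2 ≤ (ρ - 1) ^ 2 := by
      intro p hp
      obtain ⟨hpP', hr⟩ := mem_filter.1 hp
      obtain ⟨-, h1, h2, h3⟩ := (hP' p).1 hpP'
      exact ⟨h1, h2, hr, h3⟩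
    have key := card_mul_le_of_separated_in_shell RIM hsep (-(2 * R₀) + 1) (-R₀ - 1) (ρ - 2) (ρ - 1)
      (by linarith) (by linarith) (by linarith) hmem
    have e : (-R₀ - 1 - (-(2 * R₀) + 1) + 2) * (Real.pi * (ρ - 1 + 1) ^ 2 - Real.pi * (ρ - 2 - 1) ^ 2) =
        (Real.pi / 6) * (6 * R₀ * (6 * ρ - 9)) := by ring
    rw [e] at key
    have hπ : 0 < Real.pi / 6 := by positivity
    have h1 : (RIM.card : ℝ) ≤ 6 * R₀ * (6 * ρ - 9) := le_of_mul_le_mul_right (by linarith [key]) hπ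
    nlinarith
  have hcard : T.card ≤ GOOD.card + RIM.card := (card_le_card hsplit).trans (card_union_le _ _)
  have hcard' : (T.card : ℝ) ≤ (GOOD.card : ℝ) + (RIM.card : ℝ) := by exact_mod_cast hcard
  have htops' : Real.sqrt 2 * |⟪A u, EuclideanSpace.single (2 : Fin 3) (1 : ℝ)⟫_ℝ| * Real.pi * (ρ - 1) ^ 2 -
      10 * Real.sqrt 2 * Real.pi * (ρ - 1) ≤ (T.card : ℝ) := by convert htops using 3
  linarith

end Summit.Ventures.Crystal3D.Theorems

end
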